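import Mathlib
import HarnessLib
import HarnessLib.Audit
import Summits.HubbardSuperconductivity.Statement
import HarnessLib.Audit.Status.Attr

/-!
Route: BcsKacWindow

DORMANT since 2026-08-24T10:40:19Z (reconciler: no traction for 6.7 d (last activity item-evidence-added at 2026-08-17T16:59:00Z); parked, not closed — `ledger route dormant route-HubbardSuperconductivity-BcsKacWindow --off` to reactiva) — unstaffed, not closed; items shared with open routes are served there. `ledger route dormant <id> --off` reactivates.

# Route BcsKacWindow — HubbardSuperconductivity (card bcs-kac-window: "BCS is a Kac limit"; planner
plancard 2026-08-15)

## Thesis X (it suffices to show)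
Tie the torus side L to the coupling U through a BCS gap scale Δ(U), flat in U
(e^{-κ₂/U²} ≤ Δ(U) ≤ e^{-κ₁/U²}; informally Δ = W e^{-1/λ_d}, λ_d = a_d(δ)ρU² the Kohn–Luttinger B₁g
coupling),
and split weak-coupling S along the SIZE axis into three regimes:
 (A) sub-Anderson tori, L² ≤ e^{κ/U²} ≪ L_A² = 1/(ρΔ): every sector ground state is a dressed Fermi
liquid,
     λ_max(ρ₂) = O(1) — no pair condensate of any symmetry (crux NoCondensateBelowAndersonLength);
 (B) the COHERENCE WINDOW s₀ ≤ Δ(U)·L ≤ s (Anderson length ≪ L ≲ s·ξ(U), ξ = v_F/Δ the Kac range):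
for every s,
     once U < U₁(s), EVERY (N_L,S^z=0)-sector ground state of hubbardTorus 2 L 1 U (δ ∈ [a,b] ⊂
(0,1/2), L even)
     has d_{x²-y²} pair-field LRO density L⁻⁴Re⟨Δ_d†Δ_d⟩ ≥ c₀Δ(U)² with c₀ INDEPENDENT of s
     (crux CoherenceWindowLRO — a limit theorem: below the gap scale only the exact q=0 rotor and
O(s²) pair-momentum
     modes are soft, everything above K·Δ is the normal-state multiscale stage; no infinite tower of
Goldstone scales);
 (C) the CORNER s → ∞ before U → 0: the window bound persists for all even L ≥ s₁/Δ(U) at fixed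
small U
     (crux InfraredCompletion, stated as the transfer (B) ⇒ bulk — the d=2, T=0 Goldstone infrared
problem, isolated).
X := CoherenceWindowLRO ∧ InfraredCompletion. In corner form (item Target): there are 0<a<b<1/2 and
U₀>0 such that for
all δ∈[a,b] and U∈(0,U₀) some c>0, L₀ give c ≤ L⁻⁴Re⟨ψ,Δ_d†Δ_dψ⟩ for every even L ≥ L₀ and every
normalised sector GS ψ.

Lean (X → S is item Assembly; all constants exist, Sketch elaborates rc 0):
`CoherenceWindowLRO → InfraredCompletion → PairDensityBounded → HubbardSuperconductivity`, where
e.g.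
Target := ∃ a b U₀ : ℝ, 0 < a ∧ a < b ∧ b < 1/2 ∧ 0 < U₀ ∧ ∀ δ ∈ Set.Icc a b, ∀ U ∈ Set.Ioo (0:ℝ)
U₀, ∃ c L₀ : ℝ, 0 < c ∧
  ∀ (L : ℕ) [NeZero L], Even L → L₀ ≤ L → ∀ ψ, star ψ ⬝ᵥ ψ = 1 →
  Literature.MathematicalPhysics.QuantumLattice.IsGroundStateInSector (…hubbardTorus 2 L 1 U) (2 *
⌊(1 - δ) * (L:ℝ)^2 / 2⌋₊) 0 ψ →
  c ≤ (…expect ((…pairField …dWaveFormFactor L)ᴴ * …pairField …dWaveFormFactor L) ψ).re / (L:ℝ)^4.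
Assembly proof (bookkeeping, provable now): U := U₁/2, δ := a; for k with Δ(U)·2k ≥ s₁ the
window/corner bound gives
(2k)⁻⁴Re⟨Δ_d†Δ_d⟩ ≥ c₁Δ(U)² > 0; Σ over halfOpenBox² of torusPullback (pairFieldCorr d ψ) (2k) =
Re⟨ψ_{2k},Δ_d†Δ_dψ_{2k}⟩
(torusProj_bijOn_halfOpenBox, card_halfOpenBox, linearity of expect, pairField = Σ_x localPair);
PairDensityBounded caps the
sequence so Filter.liminf is not Lean-junk; hence 0 < c₁Δ² ≤ liminf, i.e. HasLongRangeOrder … as in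
the Statement (even L only,
U > 0, δ = a ∈ (0,1/2): the summit window is matched exactly).

Rationale: WHY THIS LINE. S fixes U>0 and sends L→∞; the card (bcs-kac-window) exchanges the limits: U→0⁺ with
L tied to the gap
scale Δ(U)~e^{-1/(a_dρU²)}. In that scaling the two things nobody can do — cross the Cooper pole
with infinitely many scales
below it, and control a type-A Goldstone mode for fermions in d=2 at T=0 — are never requested until
the last step:
below L_A=(ρΔ)^{-1/2} the finite-L Cooper logarithm λ_d·log(ρWL²) stays <1 (Thouless/Anderson
criterion [Anderson1959,
VondelftRalph2001, MatveevLarkin1997]); between L_A and s·ξ(U) every degree of freedom is either the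
normal-state
multiscale stage above K·Δ [BenfattoGiulianiMastropietro2006, Salmhofer1999,
FeldmanKnorrerTrubowitz2004, Mastropietro2008
Ch.15] or finite in number (exact q=0 rotor by number conservation + O(s²) pair-momentum modes) —
BCS mean field is exact
there for the same reason it is exact for Kac/long-range pair interactions [BruDesiqueiraAlves2024,
LebowitzPenrose1966]:
"the coherence length is the Kac range". Imported areas: constructive fermionic RG (stage above Δ),
Bogoliubov/Richardson
finite-dimensional BCS analysis (below Δ), diophantine geometry of torsion points (uniform
Fermi-shell multiplicities,
[ConwayJones1976]; Beukers–Smyth 2002) for every-GS control through Hund shells. Catalogue entry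
used: pass to the limit
object / regime decomposition along the size axis; physical analogy (Kac limit) WITH dictionary ξ(U)
↦ Kac range 1/γ,
BCS gap equation ↦ van der Waals–Maxwell isotherm, S ↦ fixed-range transition.

RANKED CRUXES (signatures elaborate; Δ pinned flat-in-U, windows in Δ(U)·L so no Kohn–Luttinger
vocabulary is needed):
 2 CoherenceWindowLRO — ∀s ∃U₁(s): every sector GS on even tori with s₀≤Δ(U)L≤s has L⁻⁴Re⟨Δ_d†Δ_d⟩ ≥
c₀Δ(U)², c₀ uniform
   in s (defeats the free-gas background C/L²). The card's Target ξ in provable-strength form; most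
informative.
 3 NoCondensateBelowAndersonLength — L² ≤ e^{κ/U²} ⇒ λ_max(ρ₂(ψ)) ≤ C for every sector GS (no
condensate of ANY symmetry);
   the s≪1 half of the Anderson dichotomy; needs the Morel–Anderson running A1g coupling beyond
L~e^{a/U} and the shell bound.
 4 InfraredCompletion — TRANSFER: the window bound (hypothesis, verbatim body of crux 2) ⇒ the same
bound for ALL even
   L ≥ s₁/Δ(U) at fixed small U. This is the non-commuting corner = the whole IR problem, named;
staffed after crux 2 lands.
 0 Target (corner, plain form) · 1 Assembly · 9 PairDensityBounded (‖c_i‖≤1 ⇒ density ≤ 8; makes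
liminf non-junk) ·
 9 ShellMultiplicityBound (#{(a,b)∈(ℤ/L)²: cos(2πa/L)+cos(2πb/L)=E} ≤ M₀ for E≠0; scan L≤840: max 24
at L≡0 mod 60).
Shared flank NOT re-filed: B₁g is the leading Kohn–Luttinger channel on [a,b]
(stmt-HubbardSuperconductivity-0158,
WeakCouplingBCS) — fixes the admissible doping window; RaghuKivelsonScalapino2010 Fig. 2
(non-rigorous) suggests [0.1,0.35].

KILL CRITERIA. (i) 0158 certified false for all δ∈(0,1/2) at t'=0 ⇒ close (d-wave never leads). (ii)
A refutation of
CoherenceWindowLRO (e.g. ED/DMRG at U=1.5–2, L=8–16 showing λ_max(ρ₂)/(ρΔL²) not growing across L_A,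
or a proof that the
dressing cannot be norm-small uniformly in the window) ⇒ close or restate state-restricted. (iii)
NoCondensateBelowAndersonLength
refuted at arithmetic L by unbounded shells ⇒ restate with C depending on shell multiplicity
(ShellMultiplicityBound decides).
(iv) InfraredCompletion refuted (window order without bulk order at some small U) would be a major
negative result on S itself.

DELIBERATELY NOT DECOMPOSED: the stage-1 multiscale expansion (sectors, Ward identities, running
Cooper couplings), the
Richardson/crossover functions F_δ(s) and parity gaps of the card's Target A (finer than
exponent-scale windows), the
number-projection/Bogoliubov analysis below Δ (definition request reducedBCSTorus filed for it),
ensemble questions, any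
quantitative κ's, and the choice of IR engine for crux 4 (abelian duality / Balaban-type /
window-penalty cards are candidates).
NOVELTY and BARRIERS: see the dedicated sections (passed with --novelty/ --barriers).

Novelty: NOVELTY (searched this pass, 2026-08-15: `lit search --hybrid "BCS gap equation finite box weak
coupling limit … Hainzl Seiringer"`
(held: Mastropietro2008 pp.231–232, Deutscher 2011 p.129 granular SC); `lit search --source
crossref` ×5: finite-size/Richardson BCS
(Combescot–Pogosov–Betbeder-Matibet 2013 doi:10.1016/j.physc.2012.10.011; Shen–Isaac–Links 2020
doi:10.21468/scipostphyscore.2.1.001),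
BCS functional in boxes/GL (Deuchert–Hainzl–Maier 2023 doi:10.2140/pmp.2023.4.1;
Hainzl–Roos–Seiringer 2023 doi:10.4171/jst/439;
Frank–Hainzl–Langmann 2019 doi:10.4171/jst/270), Kac→mean-field for quantum lattices (Bru–de
Siqueira Pedra–Alves 2024
doi:10.4310/atmp.2024.v28.n1.a3 = arXiv:2203.01021), ultrasmall grains (von
Delft–Zaikin–Golubev–Tichy 1996, Smith–Ambegaokar 1996
doi:10.1103/physrevlett.77.4962, Matveev–Larkin 1997, von Delft–Ralph 2001); `lit frontier
HubbardSuperconductivity --since 2020`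
(arXiv:2601.18868 Cooper condensation & pair wavefunctions; arXiv:2501.18141 mean-field AF gap);
openalex/arXiv APIs 429, galaxy queue
saturated (logged). Card-level audit (refuter -10/ -15) already graded the MECHANISM new-combination.
Nearest prior art: (1) BruDesiqueiraAlves2024 — Kac limit of quantum lattice systems with an
EXPLICIT long-range (Kac) term converging to
the mean-field/Bogoliubov model (pressure and equilibrium states); (2) HainzlSeiringer2008 and the
Hainzl–Seiringer–Frank–Deuchert school —
weak-coupling/finite-box asymptotics INSIDE the BCS functional (no many-body  [refs: 10.1016/j.physc.2012.10.011, 10.21468/scipostphyscore.2.1.001, 10.2140/pmp.2023.4.1, 10.4171/jst/439, 10.4171/jst/270, 10.4310/atmp.2024.v28.n1.a3, 10.1103/physrevlett.77.4962, 2203.01021, 2601.18868, 2501.18141, doi:10.1016/j.physc.2012.10.011, doi:10.21468/scipostphyscore.2.1.001, doi:10.2140/pmp.2023.4.1, doi:10.4171/jst/439, doi:10.4171/jst/270, doi:10.4310/atmp.2024.v28.n1.a3, doi:10.1103/phy]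

Barriers (technique_class: scaling-window constructive-RG weak-coupling-expansion): Literature.Barriers.HubbardSuperconductivity.WeakCouplingCeiling: APPLIES to every positive crux and
is respected, not denied. NoCondensateBelowAndersonLength and the stage above K·Δ in
CoherenceWindowLRO need the expansion only where the B₁g ladder is a FIXED distance below its pole
(finite-L Cooper log λ_d·log(ρWL²) ≤ θ < 1; the box, not temperature, is the IR regulator — log β ↦
2 log L); below K·Δ the window leaves finitely many soft modes (exact q=0 rotor + O(s²) pair
momenta), not infinitely many scales. What is genuinely beyond the proved domain (BGM2006 Thm 1.1: T
≥ e^{-a/U}, μ ∈ (-4,-2-√2) only): reaching e^{-κ/U²} requires the Morel–Anderson/asymptotically-free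
resummation of the repulsive A1g Cooper ladder (Salmhofer1999 p.138) at the summit's densities —
conceded; it is why CoherenceWindowLRO is rank 2 and the sub-Anderson crux rank 3. The folklore
clause "no resummation crosses T_c" is only challenged by InfraredCompletion (rank 4), which is
labelled as the whole IR problem.
Literature.Barriers.HubbardSuperconductivity.PerturbativeInvisibilityOfPairing: APPLIES formally
(Δ(U) is flat at U=0⁺) and is EVADED per its scope caveat (b): every window statement is
trans-series by construction — Δ(U) is pinned between e^{-κ₂/U²} and e^{-κ₁/U²} and the observables
are functions of Δ(U)·L, never power series in U.
Literature.Barriers.HubbardSuperconductivity.LROForcesLowLyingStates: APPLIES in regimes (B),(C) and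
is ABSORBED: no uniform gap is claimed anywhere; number cons

Novelty grade: new-combination — ROUTE REVIEW #2 (refuter 63bb7716, 2026-08-15; CONCURS with 80a57a10, whose item notes on 1319–1325 stand). 7/7 elaborate via the route module (W2.lean rc0). MAIN OBJECTION CONFIRMED independently: CoherenceWindowLRO (1319) and InfraredCompletion (1321) pin ONE gap scale Δ : ℝ → ℝ for all δ ∈ [a,b], (refuter refuter-rreview-route-PneNP-PositionalGa-63bb7716-0, 2026-08-15T12:14:49Z; prior: doi:10.4310/atmp.2024.v28.n1.a3, BenfattoGiulianiMastropietro2006, HainzlSeiringer2008)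

History (route lifecycle, newest last):
- 2026-08-16T02:17:27Z · AUTO-CRUX: 1 conjecture-grade item(s) promoted to crux (ShellMultiplicityBound) — refuter vetting / tiering apply (operator:999:1362873)
- 2026-08-24T10:40:19Z · DORMANT — reconciler: no traction for 6.7 d (last activity item-evidence-added at 2026-08-17T16:59:00Z); parked, not closed — `ledger route dormant route-HubbardSupercond (operator:999:3488420)

sub-problem: HubbardSuperconductivity · status: dormant · opened planner-plancard-HubbardSuperconductivity-Hub-1ff2d715-0 2026-08-15T10:54:35Z · rev 4 · ledger route-HubbardSuperconductivity-BcsKacWindow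
GENERATED by the gate from the ledger (D-0016/17). Provers cite these decls: `theorem foo : Summit.HubbardSuperconductivity.HubbardSuperconductivity.Theses.BcsKacWindow.<Decl> := …` in Summits/HubbardSuperconductivity/HubbardSuperconductivity/Theorems/<Name>.lean.
-/

namespace Summit.HubbardSuperconductivity.HubbardSuperconductivity.Theses.BcsKacWindow

open scoped BigOperators Topology Manifold Classical MeasureTheory ProbabilityTheory Matrix InnerProductSpace ComplexConjugate ContinuousMap
open Filter Set Function TopologicalSpace MeasureTheory

attribute [summit_statement] _root_.HubbardSuperconductivity

open Literature.Hubbard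

/-- item stmt-HubbardSuperconductivity-1322 · target · rank 0 · open · by planner
why it might fail: It is S uniformly on a weak-coupling window: false if d_{x²-y²} is not the T=0 bulk order of the pure t'=0 model at small U on any doping interval in (0,1/2) (at O(U²) it leads only for 0.6<n<1, RKS2010; higher orders/competing order unexcluded), or if every-GS uniformity breaks at level crossings.
sources: RaghuKivelsonScalapino2010, SimkovicEtAl2016, ArovasBergKivelsonRaghu2022, KomaTasaki1994
THE WEAK-COUPLING CORNER (X in plain form). ∃ 0<a<b<1/2, U₀>0: ∀δ∈[a,b] ∀U∈(0,U₀) ∃c>0 ∃L₀: every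
even L ≥ L₀ and every normalised (2⌊(1-δ)L²/2⌋,S^z=0)-sector GS ψ of hubbardTorus 2 L 1 U has c ≤
L⁻⁴Re⟨ψ,Δ_d†Δ_dψ⟩. Follows from CoherenceWindowLRO + InfraredCompletion by bookkeeping (c :=
c₁Δ(U)², L₀ := s₁/Δ(U)); implies HubbardSuperconductivity with PairDensityBounded exactly as in
Assembly (U := U₀/2, δ := a). Differs from WeakCouplingBCS.WcbcsThesis (δ∈(0,1), all L incl. odd,
HasPairFieldLRO per sequence) by matching the summit window exactly: δ⊂(0,1/2), EVEN L only, U>0,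
uniform-in-GS form. -/
@[route_item "route-HubbardSuperconductivity-BcsKacWindow"]
def Target : Prop :=
  ∃ a b U₀ : ℝ, 0 < a ∧ a < b ∧ b < 1 / 2 ∧ 0 < U₀ ∧ ∀ δ ∈ Set.Icc a b, ∀ U ∈ Set.Ioo (0:ℝ) U₀, ∃ c L₀ : ℝ, 0 < c ∧ ∀ (L : ℕ) [NeZero L], Even L → L₀ ≤ L → ∀ ψ : Literature.MathematicalPhysics.QuantumLattice.Fock (Literature.MathematicalPhysics.QuantumLattice.Orb (Literature.MathematicalPhysics.QuantumLattice.FermionTorus 2 L)), star ψ ⬝ᵥ ψ = 1 → Literature.MathematicalPhysics.QuantumLattice.IsGroundStateInSector (Literature.MathematicalPhysics.QuantumLattice.hubbardTorus 2 L 1 U) (2 * ⌊(1 - δ) * (L : ℝ) ^ 2 / 2⌋₊) 0 ψ → c ≤ (Literature.MathematicalPhysics.QuantumLattice.expect ((Literature.MathematicalPhysics.QuantumLattice.pairField Literature.MathematicalPhysics.QuantumLattice.dWaveFormFactor L)ᴴ * Literature.MathematicalPhysics.QuantumLattice.pairField Literature.MathematicalPhysics.QuantumLattice.dWaveFormFactor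 L) ψ).re / (L : ℝ) ^ 4

/-- item stmt-HubbardSuperconductivity-1319 · crux · rank 2 · open · by planner
why it might fail: Mis-typed: Δ(U) δ-independent but κ(δ)∝α₂(1-δ) varies (RKS2010): for a<b the window is mesoscopic at ≤1 doping and needs bulk LRO elsewhere; stage above K·Δ proved only for T≥e^{-a/|U|}, μ<(2-√2)/2, L=∞ (Mastropietro2008 Thm 14.1); A1g resummation to e^{-κ/U²}, every-GS control below Δ unbuilt.
sources: RaghuKivelsonScalapino2010, Mastropietro2008, BenfattoGiulianiMastropietro2006, Salmhofer1999, FeldmanKnorrerTrubowitz2004, BruDesiqueiraAlves2024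
COHERENCE WINDOW (card bcs-kac-window, Target ξ in provable-strength form). There are a doping
window [a,b]⊂(0,1/2), a gap scale Δ(U) pinned flat in U (e^{-κ₂/U²} ≤ Δ(U) ≤ e^{-κ₁/U²}; informally
Δ = W e^{-1/λ_d}, λ_d = a_d(δ)ρU² the Kohn–Luttinger B1g coupling), c₀>0 and s₀>0 such that FOR
EVERY window top s ≥ s₀ there is U₁(s)>0 with: for all δ∈[a,b], U∈(0,U₁), every EVEN L with s₀ ≤
Δ(U)·L ≤ s and every normalised (2⌊(1-δ)L²/2⌋, S^z=0)-sector ground state ψ of hubbardTorus 2 L 1 U,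
L⁻⁴Re⟨ψ,Δ_d†Δ_dψ⟩ ≥ c₀Δ(U)². The constant c₀ is UNIFORM in s (only U₁ depends on s): this defeats
the free-gas background C/L² ≈ CΔ²/s² and makes the statement a genuine mesoscopic-condensate
statement; s-uniformity of U₁ is NOT claimed (that is InfraredCompletion). Why easier than S: in the
window L_A=(ρΔ)^{-1/2} ≪ L ≲ (s/v_F)ξ(U), so below the gap scale the only soft modes are the exact
q=0 rotor (number conservation: sector GS are the symmetric tower members, ⟨Δ_d⟩=0 but
⟨Δ_d†Δ_d⟩/L⁴≈m², m≈ρΔlog(W/Δ)) and O(s²) pair-momentum (Anderson–Bogoliubov) modes with c_s·2π/L ≳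
Δ/s; everything above K·Δ is the normal-state multiscale stage with the B1g ladder a fixed distance
below its pole (box = IR regulato -/
@[route_item "route-HubbardSuperconductivity-BcsKacWindow", crux]
def CoherenceWindowLRO : Prop :=
  ∃ (a b κ₁ κ₂ c₀ s₀ : ℝ) (Δ : ℝ → ℝ), 0 < a ∧ a < b ∧ b < 1 / 2 ∧ 0 < κ₁ ∧ κ₁ ≤ κ₂ ∧ 0 < c₀ ∧ 0 < s₀ ∧ (∀ U : ℝ, 0 < U → Real.exp (-(κ₂ / U ^ 2)) ≤ Δ U ∧ Δ U ≤ Real.exp (-(κ₁ / U ^ 2))) ∧ ∀ s : ℝ, s₀ ≤ s → ∃ U₁ : ℝ, 0 < U₁ ∧ ∀ δ ∈ Set.Icc a b, ∀ U ∈ Set.Ioo (0:ℝ) U₁, ∀ (L : ℕ) [NeZero L], Even L → s₀ ≤ Δ U * L → Δ U * L ≤ s → ∀ ψ : Literature.MathematicalPhysics.QuantumLattice.Fock (Literature.MathematicalPhysics.QuantumLattice.Orb (Literature.MathematicalPhysics.QuantumLattice.FermionTorus 2 L)), star ψ ⬝ᵥ ψ = 1 → Literature.MathematicalPhysics.QuantumLattice.IsGroundStateInSector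 (Literature.MathematicalPhysics.QuantumLattice.hubbardTorus 2 L 1 U) (2 * ⌊(1 - δ) * (L : ℝ) ^ 2 / 2⌋₊) 0 ψ → c₀ * Δ U ^ 2 ≤ (Literature.MathematicalPhysics.QuantumLattice.expect ((Literature.MathematicalPhysics.QuantumLattice.pairField Literature.MathematicalPhysics.QuantumLattice.dWaveFormFactor L)ᴴ * Literature.MathematicalPhysics.QuantumLattice.pairField Literature.MathematicalPhysics.QuantumLattice.dWaveFormFactor L) ψ).re / (L : ℝ) ^ 4

/-- item stmt-HubbardSuperconductivity-1320 · crux · rank 3 · open · by planner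
why it might fail: Needs a T=0 expansion at densities in (1/2,1) to scale e^{-κ/U²}, past the proved domain (T≥e^{-a/|U|}, μ<(2-√2)/2, L=∞: Mastropietro2008 Thm 14.1) with the repulsive A1g ladder resummed (Salmhofer1999 (4.204)), open; uniform C over EVERY sector GS needs bounded open shells; (π,π) nesting.
sources: Anderson1959, VondelftRalph2001, MatveevLarkin1997, Mastropietro2008, BenfattoGiulianiMastropietro2006, Salmhofer1999
SUB-ANDERSON TORI CARRY NO CONDENSATE (the s≪1 half of the Anderson dichotomy; calibration theorem:
no torus numerics below the Anderson length can show pairing, for ANY ground state and ANY pairing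
symmetry). There are [a,b]⊂(0,1/2), κ>0, C, U₀>0 such that for δ∈[a,b], U∈(0,U₀), every even L with
L² ≤ e^{κ/U²} and every normalised sector GS ψ: λ_max(ρ₂(ψ)) = (twoParticleRDM ψ).supRayleigh ≤ C.
Mechanism: the finite-L Cooper logarithm ℓ_L ≈ ρ̄ log(ρ̄WL²); for L² ≤ e^{κ/U²} with κ < 1/(a_dρ̄)
the B1g ladder a_dρ̄U²ℓ_L stays < θ < 1 and is summable, the A1g ladder is repulsive and
asymptotically free (Morel–Anderson; Salmhofer1999 p.138), so every sector GS is a dressed Fermi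
liquid ⊗ an open-shell Hund multiplet and Yang's λ_max is O(1)+O(shell multiplicity) (≤ 24+O(1) by
ShellMultiplicityBound's scan). Range is exponential in 1/U² on purpose: it strictly exceeds the
naive perturbative window L ≤ e^{a/2U} of card finite-torus-cooper-log, which forces the
running-coupling (Morel–Anderson) content. Fallback restatement if refuted at arithmetic L: C ↦
C·(multiplicity of the open shell). -/
@[route_item "route-HubbardSuperconductivity-BcsKacWindow"]
def NoCondensateBelowAndersonLength : Prop :=
  ∃ a b κ C U₀ : ℝ, 0 < a ∧ a < b ∧ b < 1 / 2 ∧ 0 < κ ∧ 0 < U₀ ∧ ∀ δ ∈ Set.Icc a b, ∀ U ∈ Set.Ioo (0:ℝ) U₀, ∀ (L : ℕ) [NeZero L], Even L → (L : ℝ) ^ 2 ≤ Real.exp (κ / U ^ 2) → ∀ ψ : Literature.MathematicalPhysics.QuantumLattice.Fock (Literature.MathematicalPhysics.QuantumLattice.Orb (Literature.MathematicalPhysics.QuantumLattice.FermionTorus 2 L)), star ψ ⬝ᵥ ψ = 1 → Literature.MathematicalPhysics.QuantumLattice.IsGroundStateInSector (Literature.MathematicalPhysics.QuantumLattice.hubbardTorus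 2 L 1 U) (2 * ⌊(1 - δ) * (L : ℝ) ^ 2 / 2⌋₊) 0 ψ → (Literature.MathematicalPhysics.QuantumLattice.twoParticleRDM ψ).supRayleigh ≤ C

/-- item stmt-HubbardSuperconductivity-1321 · crux · rank 4 · open · by planner
why it might fail: It IS the d=2 T=0 continuous-symmetry IR problem for lattice fermions (phase mode + nodal quasiparticles, infinitely many scales below Δ; no reflection positivity, no engine); window-without-bulk via competing order at scales ≫ξ unexcluded; every-GS form can fail at level crossings; δ-indep. Δ.
sources: KomaTasaki1994, arXiv:1807.05847, ArovasBergKivelsonRaghu2022, LebowitzPenrose1966, RaghuKivelsonScalapino2010, Literature.Barriers.HubbardSuperconductivity.LROForcesLowLyingStates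
THE NON-COMMUTING CORNER, stated as a TRANSFER (window ⇒ bulk). Hypothesis: verbatim the body of
CoherenceWindowLRO for given parameters (a,b,κ₁,κ₂,c₀,s₀,Δ): order ≥ c₀Δ(U)² for every sector GS on
all even tori with s₀ ≤ Δ(U)L ≤ s, for every s once U<U₁(s). Conclusion: ∃ c₁>0, s₁, U₁>0 such that
for δ∈[a,b], U∈(0,U₁), EVERY even L with Δ(U)·L ≥ s₁ (no upper bound) and every normalised sector
GS: L⁻⁴Re⟨Δ_d†Δ_d⟩ ≥ c₁Δ(U)². This is exactly lim_{s→∞} before lim_{U→0}: what must be added to the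
window theorem to reach S, isolated and named — a finite-size criterion for a continuous-symmetry
T=0 order of lattice fermions in d=2 (the Anderson–Bogoliubov phase mode has ⟨δθ²⟩ ~ Δ/E_F ≪ 1
physically, but no constructive control exists). Candidate engines (cards):
abelian-duality-vortex-peierls, complex-stable-balaban-ir-engine, eat-the-goldstone,
kac-window-penalty-sandwich, aposteriori-order-criterion-cap-rg. Staffed only after
CoherenceWindowLRO lands (its hypothesis). The existential U₁ in the conclusion keeps the transfer a
weak-coupling statement (no unintended strong-coupling instances). -/
@[route_item "route-HubbardSuperconductivity-BcsKacWindow", crux]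
def InfraredCompletion : Prop :=
  ∀ (a b κ₁ κ₂ c₀ s₀ : ℝ) (Δ : ℝ → ℝ), 0 < a → a < b → b < 1 / 2 → 0 < κ₁ → κ₁ ≤ κ₂ → 0 < c₀ → 0 < s₀ → (∀ U : ℝ, 0 < U → Real.exp (-(κ₂ / U ^ 2)) ≤ Δ U ∧ Δ U ≤ Real.exp (-(κ₁ / U ^ 2))) → (∀ s : ℝ, s₀ ≤ s → ∃ U₁ : ℝ, 0 < U₁ ∧ ∀ δ ∈ Set.Icc a b, ∀ U ∈ Set.Ioo (0:ℝ) U₁, ∀ (L : ℕ) [NeZero L], Even L → s₀ ≤ Δ U * L → Δ U * L ≤ s → ∀ ψ : Literature.MathematicalPhysics.QuantumLattice.Fock (Literature.MathematicalPhysics.QuantumLattice.Orb (Literature.MathematicalPhysics.QuantumLattice.FermionTorus 2 L)), star ψ ⬝ᵥ ψ = 1 → Literature.MathematicalPhysics.QuantumLattice.IsGroundStateInSector (Literature.MathematicalPhysics.QuantumLattice.hubbardTorus 2 L 1 U) (2 * ⌊(1 - δ) * (L : ℝ) ^ 2 / 2⌋₊) 0 ψ → c₀ * Δ U ^ 2 ≤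 (Literature.MathematicalPhysics.QuantumLattice.expect ((Literature.MathematicalPhysics.QuantumLattice.pairField Literature.MathematicalPhysics.QuantumLattice.dWaveFormFactor L)ᴴ * Literature.MathematicalPhysics.QuantumLattice.pairField Literature.MathematicalPhysics.QuantumLattice.dWaveFormFactor L) ψ).re / (L : ℝ) ^ 4) → ∃ c₁ s₁ U₁ : ℝ, 0 < c₁ ∧ 0 < U₁ ∧ ∀ δ ∈ Set.Icc a b, ∀ U ∈ Set.Ioo (0:ℝ) U₁, ∀ (L : ℕ) [NeZero L], Even L → s₁ ≤ Δ U * L → ∀ ψ : Literature.MathematicalPhysics.QuantumLattice.Fock (Literature.MathematicalPhysics.QuantumLattice.Orb (Literature.MathematicalPhysics.QuantumLattice.FermionTorus 2 L)), star ψ ⬝ᵥ ψ = 1 → Literature.MathematicalPhysics.QuantumLattice.IsGroundStateInSector (Literature.MathematicalPhysics.QuantumLattice.hubbardTorus 2 L 1 U) (2 * ⌊(1 - δ) * (L : ℝ) ^ 2 / 2⌋₊) 0 ψ → c₁ * Δ U ^ 2 ≤ (Literature.MathematicalPhysics.QuantumLattice.expect ((Literature.MathematicalPhysics.QuantumLattice.pairField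 Literature.MathematicalPhysics.QuantumLattice.dWaveFormFactor L)ᴴ * Literature.MathematicalPhysics.QuantumLattice.pairField Literature.MathematicalPhysics.QuantumLattice.dWaveFormFactor L) ψ).re / (L : ℝ) ^ 4

/-- item stmt-HubbardSuperconductivity-1325 · crux (kind.auto-crux: conjecture-grade) · rank 9 · closed · proved by Summit.HubbardSuperconductivity.HubbardSuperconductivity.Theorems.BcsKacWindow.shellMultiplicityBound_proof (prover) · by planner
why it might fail: auto-crux — conjecture-grade statement (docstring avows it ('conjecture')); it is open, so it may simply be false
sources: ConwayJones1976, Beukers–Smyth, Cyclotomic points on curves, Number Theory for the Millennium I (A K Peters 2002) 67–85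
ARITHMETIC SUPPORT for the every-ground-state clauses (used by NoCondensateBelowAndersonLength; also
card finite-torus-cooper-log's d_sh): the Fermi shells of the square-lattice torus away from the
nested level are UNIFORMLY bounded: ∃M₀ ∀L ∀E≠0, #{(a,b)∈(ℤ/L)²: cos(2πa/L)+cos(2πb/L)=E} ≤ M₀ (so
the open shell of ε(k)=-2(cos k₁+cos k₂) at any density ≠ 1 holds ≤ 2M₀ electrons). E=0 (half
filling, nested Fermi curve) is excluded: multiplicity 2L-2 there. Route to a proof: solutions are
torsion points on the curve x+x⁻¹+y+y⁻¹ = 2E in 𝔾_m², which for E≠0 is not a union of torsion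
cosets, so Ihara–Serre–Tate/Lang finiteness applies and Beukers–Smyth give a bound ≤ 22·(area of the
Newton polygon = 2) = 44 uniformly in E; alternatively Conway–Jones' classification of vanishing
sums of ≤ 8 roots of unity (cos α+cos β = cos γ+cos δ). Planner scan (pure python, this session):
max multiplicity over even L ≤ 180 and L ∈ {210,240,360,420,720,840} is 24, attained at L ≡ 0 mod
60, E = (√5-1)/4·… ≈ 0.309; conjecture M₀ = 24. -/
@[route_item "route-HubbardSuperconductivity-BcsKacWindow"]
def ShellMultiplicityBound : Prop :=
  ∃ M₀ : ℕ, ∀ (L : ℕ) (E : ℝ), E ≠ 0 → (Finset.univ.filter (fun p : Fin L × Fin L => Real.cos (2 * Real.pi * (p.1 : ℕ) / L) + Real.cos (2 * Real.pi * (p.2 : ℕ) / L) = E)).card ≤ M₀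

/-- item stmt-HubbardSuperconductivity-1324 · support · rank 9 · closed · proved by Summit.HubbardSuperconductivity.HubbardSuperconductivity.Theorems.BcsKacWindow.pairDensityBounded_proof @ c225bb139d2b (prover) · by planner
sources: Scalapino1995, YangODLRO1962
ELEMENTARY CAP (provable now; needed by Assembly and by every assembly of this summit): for every L
and every normalised ψ, L⁻⁴Re⟨ψ,Δ_d†Δ_dψ⟩ ≤ C (C = 8 works): ‖c_{iσ}‖ ≤ 1 (CAR: c†c + cc† = 1 in the
Jordan–Wigner matrix model), ‖localPair d L x‖ ≤ Σ_{e∈unitSteps}|g_d(e)|/√2·2·… ≤ 2√2, ‖pairField d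
L‖ ≤ 2√2L², hence ⟨Δ_d†Δ_d⟩ ≤ 8L⁴·(star ψ ⬝ᵥ ψ). Alternative: Yang's bound
twoParticleRDM_rayleigh_le with ⟨Δ_d†Δ_d⟩ = φ_d†ρ₂φ_d, ‖φ_d‖² = 4L². -/
@[route_item "route-HubbardSuperconductivity-BcsKacWindow", crux]
def PairDensityBounded : Prop :=
  ∃ C : ℝ, ∀ (L : ℕ) [NeZero L] (ψ : Literature.MathematicalPhysics.QuantumLattice.Fock (Literature.MathematicalPhysics.QuantumLattice.Orb (Literature.MathematicalPhysics.QuantumLattice.FermionTorus 2 L))), star ψ ⬝ᵥ ψ = 1 → (Literature.MathematicalPhysics.QuantumLattice.expect ((Literature.MathematicalPhysics.QuantumLattice.pairField Literature.MathematicalPhysics.QuantumLattice.dWaveFormFactor L)ᴴ * Literature.MathematicalPhysics.QuantumLattice.pairField Literature.MathematicalPhysics.QuantumLattice.dWaveFormFactor L) ψ).re / (L : ℝ) ^ 4 ≤ C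

/-- item stmt-HubbardSuperconductivity-14395 · support · rank 9 · closed · proved by Summit.HubbardSuperconductivity.HubbardSuperconductivity.Theorems.BcsKacWindow.targetOfWindow_proof @ c225bb139d2b (prover) · by planner
sources: Scalapino1995
[support, provable now — GLUE, pure bookkeeping] Cruxes ⇒ Target: CoherenceWindowLRO →
InfraredCompletion → Target. Proof (planner Sketch.lean `targetOfWindow_proof`, sorry-free, lean
check rc 0, 12 lines; attached as item evidence): destructure CoherenceWindowLRO into
(a,b,κ₁,κ₂,c₀,s₀,Δ) + the two pins + the window bound; feed all of it verbatim to InfraredCompletion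
to get (c₁,s₁,U₁); Target's witnesses are a, b, U₀ := U₁ and, for δ ∈ [a,b], U ∈ (0,U₁): c :=
c₁·Δ(U)² > 0 (Δ(U) ≥ exp(−κ₂/U²) > 0 by the lower pin) and L₀ := s₁/Δ(U) (div_le_iff₀: s₁/Δ(U) ≤ L ⇔
s₁ ≤ Δ(U)·L); the bulk bound of InfraredCompletion is then Target's inequality. Role in the route:
answers the route-choice hold target-unreachable (operator, 2026-08-16T02:56:59Z) — it makes the
rank-0 Target the conclusion of the two thesis cruxes INSIDE the route graph; the deciding theorem
is closes := StatementOfTarget (TargetOfWindow hW hI) hP. PROVERS: do NOT import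
…Theses.BcsKacWindow in the closing module (the gate links <Decl>_holds by importing your module
INTO the route file — a module importing the route file cycles); state the theorem with the bodies
of CoherenceWindowLRO / InfraredCompletion / Target inlined ve -/
@[route_item "route-HubbardSuperconductivity-BcsKacWindow", crux]
def TargetOfWindow : Prop :=
  CoherenceWindowLRO → InfraredCompletion → Target

/-- item stmt-HubbardSuperconductivity-14396 · support · rank 9 · closed · proved by Summit.HubbardSuperconductivity.HubbardSuperconductivity.Theorems.BcsKacWindow.statementOfTarget_proof @ c225bb139d2b (prover) · by planner
sources: Scalapino1995, FriedliVelenik2017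
[support, provable now — GLUE, bookkeeping + the textbook liminf step] Target ⇒ S given the
elementary cap: Target → PairDensityBounded → HubbardSuperconductivity. Proof (planner Sketch.lean
`statementOfTarget_proof`, sorry-free, lean check rc 0, 45 lines, imports
Literature.MathematicalPhysics.QuantumLattice.PairCorrelationsProofs; attached as item evidence):
from Target take (a,b,U₀) and instantiate δ := a (∈ [a,b] and ∈ (0,1/2) since 0<a<b<1/2), U := U₀/2
∈ (0,U₀), getting c > 0 and L₀; unfold HubbardSuperconductivity to
Literature.Hubbard.DWaveSuperconductivityHubbard and HasLongRangeOrder to 0 < liminf_k u_k, u_k =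
(Σ_{x,y ∈ halfOpenBox 2 (2k)} torusPullback (pairFieldCorr dWaveFormFactor ψ) (2k) x y)/card²; for k
≥ 1 write 2k = n+1 (obtain n; rw) and rewrite u_k = Re⟨ψ_{n+1}, (pairField d (n+1))ᴴ·pairField d
(n+1) ψ_{n+1}⟩/(n+1)⁴ by torusLROSeq_pairFieldCorr_succ; the Statement's hypothesis at the even side
n+1 gives normalisation and IsGroundStateInSector with N (n+1) = 2⌊(1−a)(n+1)²/2⌋₊ (rw the N-clause
into the sector hypothesis); PairDensityBounded gives u_k ≤ C for k ≥ 1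
(isCoboundedUnder_ge_of_eventually_le — this is what keeps Mathlib's real liminf off its junk value
0 -/
@[route_item "route-HubbardSuperconductivity-BcsKacWindow", crux]
def StatementOfTarget : Prop :=
  Target → PairDensityBounded → HubbardSuperconductivity

/-- item stmt-HubbardSuperconductivity-1323 · assembly · rank 1 · closed · proved by Summit.HubbardSuperconductivity.HubbardSuperconductivity.Theorems.BcsKacWindow.bcsKacWindow_assembly_proof @ c225bb139d2b (prover) · by planner
sources: Scalapino1995
X → S, provable now (bookkeeping). From CoherenceWindowLRO obtain (a,b,κ₁,κ₂,c₀,s₀,Δ) and the window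
bound; InfraredCompletion gives c₁,s₁,U₁; take U := U₁/2 > 0 and δ := a ∈ (0,1/2). For N, ψ as in
the Statement and k with Δ(U)·2k ≥ s₁ (Δ(U) > 0 by its lower pin): rewrite N(2k) = 2⌊(1-δ)(2k)²/2⌋₊,
get (2k)⁻⁴Re⟨ψ_{2k},Δ_d†Δ_dψ_{2k}⟩ ≥ c₁Δ(U)². Identify the Statement's summand: Σ_{x,y∈halfOpenBox 2
(2k)} torusPullback (pairFieldCorr dWaveFormFactor ψ) (2k) x y = Σ_{x,y:TorusSite} Re
expect((localPair d (2k) x)ᴴ localPair d (2k) y) (torusProj_bijOn_halfOpenBox, pairFieldCorr_succ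
with 2k=(2k-1)+1) = Re expect((pairField d (2k))ᴴ pairField d (2k)) (pairField = Σ_x localPair,
conjTranspose_sum, sum_mul_sum, linearity of expect = star ψ ⬝ᵥ (A *ᵥ ψ)); card_halfOpenBox gives
((2k)²)² = (2k)⁴. PairDensityBounded bounds the sequence above (Lean's Filter.liminf of an unbounded
real sequence is junk 0), so 0 < c₁Δ(U)² ≤ liminf: HasLongRangeOrder (fun k => halfOpenBox 2 (2k))
(fun k => torusPullback (pairFieldCorr dWaveFormFactor ψ) (2k)). NeZero (2k) for k ≥ 1 by ⟨by
omega⟩. -/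
@[route_item "route-HubbardSuperconductivity-BcsKacWindow"]
def Assembly : Prop :=
  CoherenceWindowLRO → InfraredCompletion → PairDensityBounded → HubbardSuperconductivity

/-! D-0027 §2.1 — DECIDING THEOREM (planner-authored via `route open/edit --closes-file`; by planner-rchoice-HubbardSuperconductivity-BcsKa-0b83c5c7-0 2026-08-16T03:27:27Z):
its hypotheses are this route's items and its conclusion the sub-problem Statement (glue_lint), and it elaborates with this file. -/

@[closes "route-HubbardSuperconductivity-BcsKacWindow"] theorem closes (hW : CoherenceWindowLRO) (hI : InfraredCompletion) (hP : PairDensityBounded)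
    (hT : TargetOfWindow) (hS : StatementOfTarget) : _root_.HubbardSuperconductivity :=
  hS (hT hW hI) hP

end Summit.HubbardSuperconductivity.HubbardSuperconductivity.Theses.BcsKacWindow
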